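import Summits.QuantumFields.YangMills.Theses.FradkinShenkerFlow
import Summits.QuantumFields.YangMills.Theorems.FradkinShenkerFlowSusceptibilityToPoincareTransfer
import Literature.Probability.LatticeModels.GibbsSpecificationTilted

/-!
# Line `planted-link-pinning` for crux `FradkinShenkerFlow.SusceptibilityToPoincare` (stmt-QuantumFields-9441)

Skeleton v2 (lead `prover-line-stmt-QuantumFields-9441-c1-0`, 2026-08-16), RESHAPED from the planner's
skeleton `Lines/planted-link-pinning.lean` (planner-cruxplan-…-planted-link-pinning-0, commit ee31fd182637;
idea card `Ideas/planted-link-pinning.md`, triage `TRIAGE-r1-1.md`).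

The crux (FIXED, concluded BY NAME below): for every compact simple `G`, faithful unitary `r`, `β ≥ 0`,
`FS(G,r,β) → UP(G,r,β)` — finite gauge-invariant susceptibility of the torus Wilson measures `μ_{β,S}`
(uniformly in the side `2S+1`) implies a volume-uniform single-link HEAT-BATH Poincaré inequality
`Var_μ F ≤ C Σ_ℓ ∫∫ (F U − F(U[ℓ↦g]))² dν_ℓ^U dμ` for all bounded measurable `F`.

## The line and the reshape

PLANTED LINK PINNING: pin a random set of links at PLANTED values (`U ∼ μ` itself) and control the
variance of gauge-invariant observables retained by the free links; the terminal stage (free links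
conditionally INDEPENDENT given the pins) is exact and costs nothing; the orbit-slice transfer upgrades
invariant test functions to all test functions.

Reshape (v2, this lead). The planner's terminal ensemble — Bernoulli(1−ε) pinning of EVERY link, free links
forming plaquette-connected percolation clusters — made the PROVABLE terminal stub depend on a cluster
decomposition, a Holley–Stroock comparison per cluster and a lattice-animal moment bound, none of which
serves the open stub (it only made it harder: smaller terminal free sets retain less variance). v2 pins
instead the complement of a uniformly translated ISOLATED FAMILY of links,
`Φ_{a,i} = {(x, i) | x − a ∈ (2ℤ+1)⁴ (odd `val` in every coordinate)}`,
whose members pairwise share no plaquette (odd side `2S+1 ≥ 3`): given the pins the free links are EXACTLY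
independent with their one-link heat-bath laws, so the terminal stage is Efron–Stein with constant `½` and
nothing else (stubs T0/T1 below), for every compact `G`, every real `β`, every free DENSITY (`(S/L)⁴/4`).
The planted local-to-global stub keeps its nature (variance retained by a planted random free family) and
is heuristically WEAKER than v1's (larger terminal free set); at `β = 0` it holds with `C = (L/S)⁴ ≤ 81`
by the Hoeffding decomposition of product Haar measure.

## Registered stubs (sorries only in `stub_*`)

* `stub_orbitSlice` (S1) — `UP_inv ⇒ UP`; CLOSED: it is the landed transfer
  `Theorems.SusceptibilityToPoincare.transfer_upInv_up` (p80192, line orbit-slice-reduction).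
* `stub_elitzurBessel` (S2, provable, M–L) — Elitzur–Bessel `Σ_ℓ Var_μ(E_μ[φ | U_ℓ]) ≤ Var_μ φ` on tori of
  side `≥ 3`: distinct links are pairwise independent with Haar marginals under the gauge-invariant `μ`.
* `stub_gibbsSparseEfronStein` (T0, provable, M–L, Literature-grade abstract probability) — for the Gibbs
  specification of a bounded adapted finitely supported potential and a finite volume `Λ` meeting every
  interaction set in at most ONE site, `Var_{γ_Λ(·|η)} F ≤ ½ Σ_{x∈Λ} ∫∫ (F σ − F(σ[x↦y]))² dν_x^σ(y) dγ_Λ(σ|η)`,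
  `ν_x^σ = ν.tilted(−β H_{{x}}(σ[x↦·]))` (the kernel is a product of its one-site tilts; tree Efron–Stein).
* `stub_sparseTerminal` (T1, provable, M–L) — torus instantiation, taking T0's statement as a hypothesis:
  `(L⁴)⁻¹ Σ_{i,a} ∫ (F − μ[F | links off Φ_{a,i}])² dμ ≤ C ℰ_hb(F)` for all bounded measurable `F`, all `S`
  (DLR: `isGibbsMeasure_wilsonMeasure`, `IsGibbsMeasure.condExp_ae_eq_integral`; isolation of `Φ_{a,i}`;
  `H_{{ℓ}}` vs `S_W` differ off `ℓ`, `dependsOn_hamiltonianIn_sub`; `C = ½ (S/L)⁴ ≤ 1/32`).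
* `stub_sparseLocalToGlobal` (S4, OPEN — the crux's content, HARDEST, held by the lead) — for compact simple
  SIMPLY-CONNECTED `G`: `EB → FS → ∃ C ∀ S ≥ 1 ∀ invariant bounded measurable F,
  Var_μ F ≤ C (L⁴)⁻¹ Σ_{i,a} ∫ (F − μ[F | links off Φ_{a,i}])² dμ`.  AS TYPED (`∀ β ≥ 0`, all faithful `r`)
  it inherits the crux's misstatement: bitten modulo twist-sector inputs at `G = SU(2)`,
  `r = ρ_{1/2} ⊕ k ρ₁`, Bhanot–Creutz window (drefute p77766, `Negative/TwistSectorSimplyConnected.lean`; via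
  T0/T1 + transfer, ¬UP_inv ⇒ ¬S4); the repaired crux C″ (`∀ r ∃ β₁ ∀ β ≥ β₁`, `SimplyConnectedSpace G`)
  re-types it the same way. No prover should attack the `∀ β ≥ 0` form positively.
* `stub_centrelessResidual` (S5, sentinel, NOT claimed) — `FS → UP_inv` for `¬ SimplyConnectedSpace G`; false
  modulo `Literature…TwistSectorInputs` (cdisprove p76563, `Negative/FalseOfTwistSectorInputs.lean`).
* `SusceptibilityToPoincare_of` — sorry-free composition: `π₁ = 0`: EB (S2), `C_M` (S4), `C_T` (T1 fed with
  T0), `S = 0` by the landed per-volume inequality `perVolume_heatBathPoincare`, then S1; `π₁ ≠ 0`: S5, S1.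

Disproof.lean (v3) honoured: no `_false_without_` theorem exists; §2/§3 bite only S5 (and, via p77766, the
`∀β` form of S4 — recorded above); §4: per-`S` Poincaré is true (used here for `S = 0` only), the content is
uniformity in `S` (carried by S4 alone); T0/T1/S2 are `G`-, `β`- and dimension-blind and consistent with the
`d = 5` unit test (only S4 is `d`-sensitive).

All stub statements are over `Literature` + Mathlib vocabulary ONLY (fully qualified); the `*_iff` lemmas are
`Iff.rfl` bridges to the readable predicates of §Vocabulary.
-/

set_option linter.unusedVariables false

namespace Summit.QuantumFields.YangMills.Cruxes.SusceptibilityToPoincare.PlantedLinkPinning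

open MeasureTheory ProbabilityTheory
open Literature.MathematicalPhysics.QuantumFieldTheory Literature.MathematicalPhysics.QuantumLattice
open Literature.Probability.LatticeModels (Potential hamiltonianIn gibbsSpecOfPotential)
open Summit.QuantumFields.YangMills.Theses.FradkinShenkerFlow

/-! ## Vocabulary (readable predicates; the stubs below are their verbatim expansions) -/

section Vocabulary

variable (G : Type) [Group G] [TopologicalSpace G] [IsTopologicalGroup G] [CompactSpace G]
  [MeasurableSpace G] [BorelSpace G]

/-- The single-link HEAT-BATH Dirichlet form of the crux,
`ℰ_hb(F) = Σ_ℓ ∫∫ (F U − F(U[ℓ ↦ g]))² dν_ℓ^U(g) dμ_{β,S}(U)`, `ν_ℓ^U = Haar.tilted(−β S_W(U[ℓ↦·]))` the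
one-link conditional law (`= 2 Σ_ℓ E_μ Var_{ν_ℓ^U} F`). [folklore] -/
noncomputable def hbDirichlet (r : LatticeRep G) (β : ℝ) (S : ℕ)
    (F : GaugeConfig 4 (2 * S + 1) G → ℝ) : ℝ :=
  ∑ ℓ : Edge 4 (2 * S + 1), ∫ U, ∫ g, (F U - F (Function.update U ℓ g)) ^ 2
    ∂((haarProbability G).tilted (fun g' => -β * wilsonAction r.ρ (Function.update U ℓ g')))
    ∂(wilsonMeasure (d := 4) (L := 2 * S + 1) r.ρ β)

/-- `UP(G,r,β)`: the conclusion of the crux — a heat-bath Poincaré inequality uniform in the side. -/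
def UniformPoincare (r : LatticeRep G) (β : ℝ) : Prop :=
  ∃ C : ℝ, ∀ S : ℕ, ∀ F : GaugeConfig 4 (2 * S + 1) G → ℝ, Measurable F →
    (∃ M : ℝ, ∀ U, |F U| ≤ M) →
      ProbabilityTheory.variance F (wilsonMeasure (d := 4) (L := 2 * S + 1) r.ρ β) ≤
        C * hbDirichlet G r β S F

/-- `UP_inv(G,r,β)`: the same inequality for gauge-INVARIANT bounded measurable `F` only. -/
def UniformPoincareInv (r : LatticeRep G) (β : ℝ) : Prop :=
  ∃ C : ℝ, ∀ S : ℕ, ∀ F : GaugeConfig 4 (2 * S + 1) G → ℝ, Measurable F →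
    (∃ M : ℝ, ∀ U, |F U| ≤ M) → IsGaugeInvariant F →
      ProbabilityTheory.variance F (wilsonMeasure (d := 4) (L := 2 * S + 1) r.ρ β) ≤
        C * hbDirichlet G r β S F

/-- `FS(G,r,β)`: the hypothesis of the crux — finite gauge-invariant susceptibility, uniformly in `S`. -/
def FiniteSusceptibility (r : LatticeRep G) (β : ℝ) : Prop :=
  ∀ A B : YMSpecies G, ∃ χ : ℝ, ∀ S : ℕ,
    ∑ x ∈ Literature.Probability.LatticeModels.box 4 S,
      |ProbabilityTheory.covariance (fun U => A.F (torusLift (2 * S + 1) U))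
        (fun U => B.F (configShift (-x) (torusLift (2 * S + 1) U)))
        (wilsonMeasure (d := 4) (L := 2 * S + 1) r.ρ β)| ≤ χ

/-- `σ(U_ℓ)`: the σ-algebra generated by one link variable. -/
abbrev linkSigma (S : ℕ) (ℓ : Edge 4 (2 * S + 1)) : MeasurableSpace (GaugeConfig 4 (2 * S + 1) G) :=
  MeasurableSpace.comap (fun V : GaugeConfig 4 (2 * S + 1) G => V ℓ) inferInstance

/-- `EB(G,r,β)`: spectral independence of the unpinned Wilson measure with constant 1 (Elitzur–Bessel):
`Σ_ℓ Var_μ(E_μ[φ | σ(U_ℓ)]) ≤ Var_μ φ` on every torus of side `2S+1 ≥ 3`. -/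
def ElitzurBessel (r : LatticeRep G) (β : ℝ) : Prop :=
  ∀ S : ℕ, 1 ≤ S → ∀ φ : GaugeConfig 4 (2 * S + 1) G → ℝ, Measurable φ →
    (∃ M : ℝ, ∀ U, |φ U| ≤ M) →
      ∑ ℓ : Edge 4 (2 * S + 1), ProbabilityTheory.variance
          ((wilsonMeasure (d := 4) (L := 2 * S + 1) r.ρ β)[φ | linkSigma G S ℓ])
          (wilsonMeasure (d := 4) (L := 2 * S + 1) r.ρ β) ≤
        ProbabilityTheory.variance φ (wilsonMeasure (d := 4) (L := 2 * S + 1) r.ρ β)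

variable {G} in
/-- The ISOLATED FREE FAMILY `Φ_{a,i} = {(x, i) | (x ν − a ν).val odd for every ν}`: links of one direction
based at the all-odd sites relative to the origin `a`; on a torus of odd side `≥ 3` two distinct members
share no plaquette. -/
def freeFamily (S : ℕ) (a : Site 4 (2 * S + 1)) (i : Fin 4) : Set (Edge 4 (2 * S + 1)) :=
  {ℓ | ℓ.2 = i ∧ ∀ ν, Odd (ℓ.1 ν - a ν).val}

/-- The σ-algebra of the PINNED links: all links outside the free family `Φ_{a,i}`. -/
abbrev pinnedEvents (S : ℕ) (a : Site 4 (2 * S + 1)) (i : Fin 4) :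
    MeasurableSpace (GaugeConfig 4 (2 * S + 1) G) :=
  cylinderEvents (X := fun _ : Edge 4 (2 * S + 1) => G) (freeFamily S a i)ᶜ

/-- `SCV(F)`: the SPARSE PLANTED CONDITIONAL VARIANCE — pin every link off a uniformly translated isolated
family `Φ_{a,i}` at its value in `U ∼ μ_{β,S}` and average the conditional variance:
`(L⁴)⁻¹ Σ_{i,a} ∫ (F − E_μ[F | links off Φ_{a,i}])² dμ`, `L = 2S+1`. -/
noncomputable def sparseCondVar (r : LatticeRep G) (β : ℝ) (S : ℕ)
    (F : GaugeConfig 4 (2 * S + 1) G → ℝ) : ℝ :=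
  (((2 * S + 1) ^ 4 : ℕ) : ℝ)⁻¹ *
    ∑ i : Fin 4, ∑ a : Site 4 (2 * S + 1),
      ∫ U, (F U - ((wilsonMeasure (d := 4) (L := 2 * S + 1) r.ρ β)[F | pinnedEvents G S a i]) U) ^ 2
        ∂(wilsonMeasure (d := 4) (L := 2 * S + 1) r.ρ β)

/-- `SparseLocalToGlobalAt G r β C`: the sparse planted local-to-global inequality with constant `C` for
gauge-invariant bounded measurable `F`, uniformly in `S ≥ 1`. -/
def SparseLocalToGlobalAt (r : LatticeRep G) (β C : ℝ) : Prop :=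
  ∀ (S : ℕ), 1 ≤ S → ∀ (F : GaugeConfig 4 (2 * S + 1) G → ℝ), Measurable F →
    (∃ M : ℝ, ∀ U, |F U| ≤ M) → IsGaugeInvariant F →
      ProbabilityTheory.variance F (wilsonMeasure (d := 4) (L := 2 * S + 1) r.ρ β) ≤
        C * sparseCondVar G r β S F

/-- `SparseTerminalAt G r β C`: the terminal comparison `SCV(F) ≤ C ℰ_hb(F)` for all bounded measurable `F`,
uniformly in `S`. -/
def SparseTerminalAt (r : LatticeRep G) (β C : ℝ) : Prop :=
  ∀ (S : ℕ) (F : GaugeConfig 4 (2 * S + 1) G → ℝ), Measurable F → (∃ M : ℝ, ∀ U, |F U| ≤ M) →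
    sparseCondVar G r β S F ≤ C * hbDirichlet G r β S F

end Vocabulary

/-- `GibbsSparseEfronStein`: the abstract sparse Efron–Stein inequality for Gibbsian kernels (statement of
stub T0, consumed by T1 as a hypothesis). For a probability a-priori measure `ν`, a bounded adapted
potential `Φ` supported by `supp`, a finite volume `Λ` meeting every interaction set of `supp Λ` in at most
one site, every boundary condition `η` and bounded measurable `F`:
`∫ (F − γ_Λ F)² dγ_Λ(·|η) ≤ ½ Σ_{x∈Λ} ∫∫ (F σ − F(σ[x↦y]))² dν.tilted(−β H_{{x}}(σ[x↦·]))(y) dγ_Λ(σ|η)`. -/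
def GibbsSparseEfronStein : Prop :=
  ∀ (V : Type) (X : Type) [DecidableEq V] [Countable V] [MeasurableSpace X]
    [MeasurableSingletonClass X] (ν : Measure X) [IsProbabilityMeasure ν]
    (Φ : Literature.Probability.LatticeModels.Potential V X) (supp : Finset V → Finset (Finset V))
    (β : ℝ), Φ.IsAdapted → (∀ A, ∃ C : ℝ, ∀ σ, |Φ A σ| ≤ C) → Φ.IsSupportedBy supp →
    ∀ (Λ : Finset V), (∀ A ∈ supp Λ, ∀ x ∈ A, ∀ y ∈ A, x ∈ Λ → y ∈ Λ → x = y) →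
    ∀ (η : V → X) (F : (V → X) → ℝ), Measurable F → (∃ M : ℝ, ∀ σ, |F σ| ≤ M) →
      ∫ σ, (F σ - ∫ τ, F τ
          ∂(Literature.Probability.LatticeModels.gibbsSpecOfPotential ν Φ supp β Λ η)) ^ 2
        ∂(Literature.Probability.LatticeModels.gibbsSpecOfPotential ν Φ supp β Λ η) ≤
      (1 / 2 : ℝ) * ∑ x ∈ Λ, ∫ σ, ∫ y, (F σ - F (Function.update σ x y)) ^ 2
          ∂(ν.tilted fun y' => -β *
            Literature.Probability.LatticeModels.hamiltonianIn Φ supp {x} (Function.update σ x y'))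
        ∂(Literature.Probability.LatticeModels.gibbsSpecOfPotential ν Φ supp β Λ η)

/-- Definitional bridge: the crux is `∀ G simple, ∀ r, ∀ β ≥ 0, FS → UP` in the vocabulary above. -/
theorem crux_iff :
    SusceptibilityToPoincare ↔
      ∀ (G : Type) [Group G] [TopologicalSpace G] [IsTopologicalGroup G] [CompactSpace G]
        [MeasurableSpace G] [BorelSpace G], IsCompactSimpleLieGroup G →
        ∀ (r : LatticeRep G) (β : ℝ), 0 ≤ β → FiniteSusceptibility G r β → UniformPoincare G r β :=
  Iff.rfl

/-! ## The registered stubs (`sorry` only in `stub_*`; statements over Literature + Mathlib, fully qualified) -/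

/-- **S1 · orbit-slice reduction `UP_inv ⇒ UP`** (`stub_orbitSlice`) — CLOSED: for every compact `G`,
lattice representation `r` and real `β`, a volume-uniform heat-bath Poincaré inequality for gauge-INVARIANT
bounded measurable `F` implies one for ALL bounded measurable `F`. This is the landed TRANSFER theorem of
line orbit-slice-reduction, `Theorems.SusceptibilityToPoincare.transfer_upInv_up` (p80192; from
`stub_orbitSliceSplit` p72371, `stub_orbitEfronStein` p74550, `stub_siteRotation_le` p77300,
`stub_haarResample_le_heatBath` p74627, `stub_dirichlet_orbitAverage_le` p74610). The hypothesis `0 ≤ β`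
is not used. `stub_orbitSlice_iff`: this is `∀ G r β, 0 ≤ β → UniformPoincareInv G r β → UniformPoincare G r β`. -/
theorem stub_orbitSlice :
    ∀ (G : Type) [Group G] [TopologicalSpace G] [IsTopologicalGroup G] [CompactSpace G]
      [MeasurableSpace G] [BorelSpace G],
      ∀ (r : Literature.MathematicalPhysics.QuantumFieldTheory.LatticeRep G) (β : ℝ), 0 ≤ β →
        (∃ C : ℝ, ∀ S : ℕ,
          ∀ F : Literature.MathematicalPhysics.QuantumFieldTheory.GaugeConfig 4 (2 * S + 1) G → ℝ,
            Measurable F → (∃ M : ℝ, ∀ U, |F U| ≤ M) →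
            Literature.MathematicalPhysics.QuantumFieldTheory.IsGaugeInvariant F →
              ProbabilityTheory.variance F
                  (Literature.MathematicalPhysics.QuantumFieldTheory.wilsonMeasure (d := 4)
                    (L := 2 * S + 1) r.ρ β) ≤
                C * ∑ ℓ : Literature.MathematicalPhysics.QuantumFieldTheory.Edge 4 (2 * S + 1),
                  ∫ U, ∫ g, (F U - F (Function.update U ℓ g)) ^ 2
                    ∂((Literature.MathematicalPhysics.QuantumFieldTheory.haarProbability G).tilted
                      (fun g' => -β * Literature.MathematicalPhysics.QuantumFieldTheory.wilsonAction
                        r.ρ (Function.update U ℓ g')))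
                    ∂(Literature.MathematicalPhysics.QuantumFieldTheory.wilsonMeasure (d := 4)
                      (L := 2 * S + 1) r.ρ β)) →
        (∃ C : ℝ, ∀ S : ℕ,
          ∀ F : Literature.MathematicalPhysics.QuantumFieldTheory.GaugeConfig 4 (2 * S + 1) G → ℝ,
            Measurable F → (∃ M : ℝ, ∀ U, |F U| ≤ M) →
              ProbabilityTheory.variance F
                  (Literature.MathematicalPhysics.QuantumFieldTheory.wilsonMeasure (d := 4)
                    (L := 2 * S + 1) r.ρ β) ≤
                C * ∑ ℓ : Literature.MathematicalPhysics.QuantumFieldTheory.Edge 4 (2 * S + 1),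
                  ∫ U, ∫ g, (F U - F (Function.update U ℓ g)) ^ 2
                    ∂((Literature.MathematicalPhysics.QuantumFieldTheory.haarProbability G).tilted
                      (fun g' => -β * Literature.MathematicalPhysics.QuantumFieldTheory.wilsonAction
                        r.ρ (Function.update U ℓ g')))
                    ∂(Literature.MathematicalPhysics.QuantumFieldTheory.wilsonMeasure (d := 4)
                      (L := 2 * S + 1) r.ρ β)) :=
  fun G _ _ _ _ _ _ r β _ h =>
    Summit.QuantumFields.YangMills.Theorems.SusceptibilityToPoincare.transfer_upInv_up G r β h

/-- **S2 · Elitzur–Bessel: the unpinned Wilson measure is spectrally independent with constant 1**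
(`stub_elitzurBessel`; the card's First lemma, triage r1-1 (i): TRUE for every compact `G`, every `β`,
every side `2S+1 ≥ 3`).  For bounded measurable `φ`, `Σ_ℓ Var_μ(E_μ[φ | σ(U_ℓ)]) ≤ Var_μ φ`: two distinct
links of the side-`(2S+1)` torus (`S ≥ 1`) always leave one of them an endpoint not on the other
(`ElitzurLinkCovariance.free_endpoint`); rotating the gauge there (`wilsonMeasure_map_gaugeTransform_holds`,
`integral_comp_gaugeTransform_wilsonMeasure`, right-invariance of Haar) shows the joint law of `(U_ℓ, U_ℓ')`
is invariant under `u_ℓ ↦ g u_ℓ`, hence `U_ℓ ∼ Haar` and `U_ℓ ⊥ U_ℓ'` — distinct links are PAIRWISE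
INDEPENDENT; so the centred subspaces `L²₀(σ(U_ℓ))` are pairwise orthogonal, `E[φ|U_ℓ] − Eφ` is the
orthogonal projection of `φ − Eφ` onto them, and Bessel's inequality gives the claim (equality on
`φ = f(U_ℓ)`).  `S = 0` (side 1) is correctly excluded.  Size M–L.  Leans on:
`Theorems.ElitzurLinkCovariance.{free_endpoint, integral_mul_eq_const_mul_integral,
covariance_eq_zero_of_siteRotation, integral_comp_link_wilsonMeasure_eq_haar}`,
`isProbabilityMeasure_wilsonMeasure`, Mathlib `condExp` (`integral_condExp`, pull-out, `condExp_indep_eq`),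
`ProbabilityTheory.variance`, `ProbabilityTheory.IndepFun`.
`stub_elitzurBessel_iff`: this is `∀ G r β, ElitzurBessel G r β`. -/
theorem stub_elitzurBessel :
    ∀ (G : Type) [Group G] [TopologicalSpace G] [IsTopologicalGroup G] [CompactSpace G]
      [MeasurableSpace G] [BorelSpace G],
      ∀ (r : Literature.MathematicalPhysics.QuantumFieldTheory.LatticeRep G) (β : ℝ) (S : ℕ), 1 ≤ S →
        ∀ φ : Literature.MathematicalPhysics.QuantumFieldTheory.GaugeConfig 4 (2 * S + 1) G → ℝ,
          Measurable φ → (∃ M : ℝ, ∀ U, |φ U| ≤ M) →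
            ∑ ℓ : Literature.MathematicalPhysics.QuantumFieldTheory.Edge 4 (2 * S + 1),
              ProbabilityTheory.variance
                ((Literature.MathematicalPhysics.QuantumFieldTheory.wilsonMeasure (d := 4)
                    (L := 2 * S + 1) r.ρ β)[φ |
                  MeasurableSpace.comap
                    (fun V : Literature.MathematicalPhysics.QuantumFieldTheory.GaugeConfig 4
                      (2 * S + 1) G => V ℓ) inferInstance])
                (Literature.MathematicalPhysics.QuantumFieldTheory.wilsonMeasure (d := 4)
                  (L := 2 * S + 1) r.ρ β) ≤
              ProbabilityTheory.variance φ
                (Literature.MathematicalPhysics.QuantumFieldTheory.wilsonMeasure (d := 4)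
                  (L := 2 * S + 1) r.ρ β) := by
  sorry

/-- **T0 · sparse Efron–Stein for Gibbsian kernels** (`stub_gibbsSparseEfronStein`; abstract probability,
Literature-grade — Georgii 2011 Def. 2.9 kernels + Efron–Stein 1981 / Steele 1986 / BBL 2004 Thm 5).
Let `γ = gibbsSpecOfPotential ν Φ supp β` for a probability measure `ν` on the spin space, a bounded
adapted potential `Φ` supported by `supp`, and let the finite volume `Λ` be SPARSE: every interaction set
`A ∈ supp Λ` meets `Λ` in at most one site. Then for every boundary condition `η` and bounded measurable `F`,
`∫ (F − γ_Λ F)² dγ_Λ(·|η) ≤ ½ Σ_{x∈Λ} ∫∫ (F σ − F(σ[x ↦ y]))² dν_x^σ(y) dγ_Λ(σ|η)` with the one-site law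
`ν_x^σ := ν.tilted (y ↦ −β H_{{x}}(σ[x ↦ y]))`.  Why true: `γ_Λ(·|η)` is the push-forward along
`glueWith Λ · η` of `(ν^{⊗Λ}).tilted(−β H_Λ ∘ glue)`; by sparsity and adaptedness
`H_Λ(glue ζ η) = Σ_{x∈Λ} h_x(ζ_x)` (each `A` meeting `Λ` meets it in one `x`, the other sites of `A` carry
`η`), so the tilted product is the PRODUCT of the one-site tilts `ν.tilted(−β h_x)` (uniqueness on boxes,
`Measure.pi_eq`, `integral_fintype_prod_eq_prod`), the tree's Efron–Stein inequality
`Literature.Probability.Moments.EfronSteinInequality_holds` applies to `F ∘ glue`, `glueWith Λ (update ζ x y) η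
= update (glueWith Λ ζ η) x y` (`LocalPoincare.glueWith_update`), and `−β H_{{x}}(σ[x↦·])` differs from
`−β h_x` only through interaction sets with `Φ_A = 0` or a `y`-independent constant (`IsSupportedBy`), which
`Measure.tilted` ignores (`tilted_const_add_eq`).  Size M–L.  Leans on (all proved):
`Literature.Probability.LatticeModels.{gibbsSpecOfPotential, hamiltonianIn, glueWith, Potential.IsAdapted,
Potential.IsSupportedBy, isProbabilityMeasure_tilted_map_glueWith_pi, tilted_map_glueWith_pi_apply,
dependsOn_hamiltonianIn_sub, hamiltonianIn_eq_sum_filter_of_subset}`,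
`Literature.Probability.Moments.EfronSteinInequality_holds`, Mathlib `Measure.tilted`, `Measure.pi`.
`stub_gibbsSparseEfronStein_iff`: this is `GibbsSparseEfronStein`. -/
theorem stub_gibbsSparseEfronStein :
    ∀ (V : Type) (X : Type) [DecidableEq V] [Countable V] [MeasurableSpace X]
      [MeasurableSingletonClass X] (ν : MeasureTheory.Measure X) [IsProbabilityMeasure ν]
      (Φ : Literature.Probability.LatticeModels.Potential V X) (supp : Finset V → Finset (Finset V))
      (β : ℝ), Φ.IsAdapted → (∀ A, ∃ C : ℝ, ∀ σ, |Φ A σ| ≤ C) → Φ.IsSupportedBy supp →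
      ∀ (Λ : Finset V), (∀ A ∈ supp Λ, ∀ x ∈ A, ∀ y ∈ A, x ∈ Λ → y ∈ Λ → x = y) →
      ∀ (η : V → X) (F : (V → X) → ℝ), Measurable F → (∃ M : ℝ, ∀ σ, |F σ| ≤ M) →
        ∫ σ, (F σ - ∫ τ, F τ
            ∂(Literature.Probability.LatticeModels.gibbsSpecOfPotential ν Φ supp β Λ η)) ^ 2
          ∂(Literature.Probability.LatticeModels.gibbsSpecOfPotential ν Φ supp β Λ η) ≤
        (1 / 2 : ℝ) * ∑ x ∈ Λ, ∫ σ, ∫ y, (F σ - F (Function.update σ x y)) ^ 2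
            ∂(ν.tilted fun y' => -β *
              Literature.Probability.LatticeModels.hamiltonianIn Φ supp {x} (Function.update σ x y'))
          ∂(Literature.Probability.LatticeModels.gibbsSpecOfPotential ν Φ supp β Λ η) := by
  sorry

/-- **T1 · sparse terminal stage on the torus** (`stub_sparseTerminal`; provable, M–L).  For every compact
`G`, lattice representation `r`, real `β`: IF the abstract sparse Efron–Stein inequality T0 holds, THEN there
is `C ≥ 0` (in fact `C = 1/32`) such that for all `S` and all bounded measurable `F` on the torus of side
`L = 2S+1`, `(L⁴)⁻¹ Σ_{i : Fin 4} Σ_{a} ∫ (F − μ[F | links off Φ_{a,i}])² dμ ≤ C · ℰ_hb(F)`,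
`Φ_{a,i} = {(x,i) | ∀ ν, (x ν − a ν).val odd}`, `μ = wilsonMeasure r.ρ β`.  Why true / proof route (the DLR
plumbing is that of the landed `LocalPoincare.integral_sub_condExp_sq_le`, file
`FradkinShenkerFlowSusceptibilityToPoincareLocalPoincareSmallCylinders.lean`, verbatim up to the volume):
(1) `μ` is a DLR state of the plaquette specification `γ` (`exists_plaquettePotential`,
`isGibbsMeasure_wilsonMeasure`); with `Λ :=` the finset of `Φ_{a,i}` (`(↑Λ)ᶜ = (freeFamily S a i)ᶜ`) the kernel
average `γ_Λ F` is a version of `μ[F | pinnedEvents]` (`IsGibbsMeasure.condExp_ae_eq_integral`) and by DLR +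
properness `∫ (F − μ[F|·])² dμ = ∫ [∫ (F − γ_Λ F(η))² dγ_Λ(·|η)] dμ(η)`.  (2) `Λ` is SPARSE for the plaquette
family: every `A ∈ supp Λ` is the edge set `{(y,i'),(y+e_{i'},j),(y+e_j,i'),(y,j)}` of a plaquette (last
clause of `exists_plaquettePotential`); two members of `Φ_{a,i}` in it have the same direction, hence differ
by a unit vector `e_k`, i.e. `(x ν − x' ν).val ∈ {0, 1, L−1}` for all `ν`, while distinct members of `Φ_{a,i}`
differ in some coordinate by a `val` in `[2, L−3]` (two distinct odd numbers in `[1, L−2]`) — so T0 applies.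
(3) Integrate T0's bound `dμ(η)`: DLR turns `∫∫ Ψ_ℓ dγ_Λ dμ` into `∫ Ψ_ℓ dμ`, and
`−β H_{{ℓ}}(U[ℓ↦·])` and `−β S_W(U[ℓ↦·])` differ by a constant (`hamiltonianIn … univ = wilsonAction`,
`dependsOn_hamiltonianIn_sub` with `{ℓ} ⊆ univ`), so the one-site tilt IS the heat-bath law `ν_ℓ^U` and the
`ℓ`-th term is `½` of the `ℓ`-th summand of `ℰ_hb`.  (4) Sum over `(i, a)`: each link `ℓ` lies in `Φ_{a,ℓ.2}` for
exactly `S⁴` origins `a` (`S` odd residues per coordinate), so the total is `½ S⁴ ℰ_hb(F) ≤ (L⁴/32) ℰ_hb(F)`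
(every summand of `ℰ_hb` is `≥ 0`).  Leans on: T0 (hypothesis), `exists_plaquettePotential`,
`isGibbsMeasure_wilsonMeasure`, `isSpecification_gibbsSpecOfPotential`, `IsGibbsMeasure.condExp_ae_eq_integral`,
`IsGibbsMeasure.integral_integral_eq` / the DLR identity, `dependsOn_hamiltonianIn_sub`, `tilted_const_add_eq`,
`isProbabilityMeasure_wilsonMeasure`; second countability of `G` from `r`.
`stub_sparseTerminal_iff`: this is `∀ G r β, GibbsSparseEfronStein → ∃ C ≥ 0, SparseTerminalAt G r β C`. -/
theorem stub_sparseTerminal :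
    ∀ (G : Type) [Group G] [TopologicalSpace G] [IsTopologicalGroup G] [CompactSpace G]
      [MeasurableSpace G] [BorelSpace G],
      ∀ (r : Literature.MathematicalPhysics.QuantumFieldTheory.LatticeRep G) (β : ℝ),
      -- hypothesis: the abstract sparse Efron–Stein inequality for Gibbsian kernels (= stub T0)
      (∀ (V : Type) (X : Type) [DecidableEq V] [Countable V] [MeasurableSpace X]
        [MeasurableSingletonClass X] (ν : MeasureTheory.Measure X) [IsProbabilityMeasure ν]
        (Φ : Literature.Probability.LatticeModels.Potential V X) (supp : Finset V → Finset (Finset V))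
        (β : ℝ), Φ.IsAdapted → (∀ A, ∃ C : ℝ, ∀ σ, |Φ A σ| ≤ C) → Φ.IsSupportedBy supp →
        ∀ (Λ : Finset V), (∀ A ∈ supp Λ, ∀ x ∈ A, ∀ y ∈ A, x ∈ Λ → y ∈ Λ → x = y) →
        ∀ (η : V → X) (F : (V → X) → ℝ), Measurable F → (∃ M : ℝ, ∀ σ, |F σ| ≤ M) →
          ∫ σ, (F σ - ∫ τ, F τ
              ∂(Literature.Probability.LatticeModels.gibbsSpecOfPotential ν Φ supp β Λ η)) ^ 2
            ∂(Literature.Probability.LatticeModels.gibbsSpecOfPotential ν Φ supp β Λ η) ≤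
          (1 / 2 : ℝ) * ∑ x ∈ Λ, ∫ σ, ∫ y, (F σ - F (Function.update σ x y)) ^ 2
              ∂(ν.tilted fun y' => -β *
                Literature.Probability.LatticeModels.hamiltonianIn Φ supp {x} (Function.update σ x y'))
            ∂(Literature.Probability.LatticeModels.gibbsSpecOfPotential ν Φ supp β Λ η)) →
      ∃ C : ℝ, 0 ≤ C ∧ ∀ (S : ℕ)
        (F : Literature.MathematicalPhysics.QuantumFieldTheory.GaugeConfig 4 (2 * S + 1) G → ℝ),
        Measurable F → (∃ M : ℝ, ∀ U, |F U| ≤ M) →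
          (((2 * S + 1) ^ 4 : ℕ) : ℝ)⁻¹ *
            ∑ i : Fin 4, ∑ a : Literature.MathematicalPhysics.QuantumFieldTheory.Site 4 (2 * S + 1),
              ∫ U, (F U - ((Literature.MathematicalPhysics.QuantumFieldTheory.wilsonMeasure (d := 4)
                  (L := 2 * S + 1) r.ρ β)[F | MeasureTheory.cylinderEvents
                    (X := fun _ : Literature.MathematicalPhysics.QuantumFieldTheory.Edge 4 (2 * S + 1) => G)
                    {ℓ : Literature.MathematicalPhysics.QuantumFieldTheory.Edge 4 (2 * S + 1) |
                      ℓ.2 = i ∧ ∀ ν, Odd (ℓ.1 ν - a ν).val}ᶜ]) U) ^ 2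
                ∂(Literature.MathematicalPhysics.QuantumFieldTheory.wilsonMeasure (d := 4)
                  (L := 2 * S + 1) r.ρ β) ≤
          C * ∑ ℓ : Literature.MathematicalPhysics.QuantumFieldTheory.Edge 4 (2 * S + 1),
            ∫ U, ∫ g, (F U - F (Function.update U ℓ g)) ^ 2
              ∂((Literature.MathematicalPhysics.QuantumFieldTheory.haarProbability G).tilted
                (fun g' => -β * Literature.MathematicalPhysics.QuantumFieldTheory.wilsonAction
                  r.ρ (Function.update U ℓ g')))
              ∂(Literature.MathematicalPhysics.QuantumFieldTheory.wilsonMeasure (d := 4)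
                (L := 2 * S + 1) r.ρ β) := by
  sorry

/-- **S4 · sparse planted local-to-global for simply-connected simple `G`** (`stub_sparseLocalToGlobal`;
HARDEST, load-bearing, OPEN — the crux's content in the line's form, HELD BY THE LEAD).  For compact simple
SIMPLY-CONNECTED `G`, faithful unitary `r`, `β ≥ 0`: IF the unpinned measures are spectrally independent with
constant 1 (S2's conclusion `EB`) AND `FS(G,r,β)` holds, THEN there is `C ≥ 0` such that for all `S ≥ 1` and
all gauge-invariant bounded measurable `F`, `Var_μ F ≤ C · (L⁴)⁻¹ Σ_{i,a} ∫ (F − μ[F | links off Φ_{a,i}])² dμ`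
— pinning the complement of a uniformly translated isolated family of links at PLANTED values retains a
volume-uniform fraction of the variance of every invariant observable.  TRUE at `β = 0` with `C = (L/S)⁴ ≤ 81`
(Hoeffding decomposition of product Haar: the `T`-component survives iff `T` meets `Φ_{a,i}`, probability
`≥ (S/L)⁴`).  Intended mechanism (card, Lever (a)–(c)): reveal the links off `Φ_{a,i}` of `U ∼ μ` one at a
time in random order; pathwise law of total variance; a revealed link explains variance of an invariant `φ`
only when FRAMED, through the response of `φ` to a LOCAL invariant composite — an FS susceptibility, with an
FS-free tail; EB is the base case `η(ν₀) ≤ 1`.  STATUS AS TYPED: `∀ β ≥ 0` for ALL faithful `r` inherits the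
crux's misstatement — with T0, T1 and the transfer it implies UP_inv, which is false modulo SU(2)
twist-sector inputs at `r = ρ_{1/2} ⊕ k ρ₁`, `2β ≲ 0.44 ≪ 3kβ` (drefute p77766,
`Theorems/SusceptibilityToPoincare/Negative/TwistSectorSimplyConnected.lean`); the repaired crux C″
(`SimplyConnectedSpace G`, `∀ r ∃ β₁ ∀ β ≥ β₁`) re-types this stub identically and the witness misses it.
It is ALSO strictly stronger than UP_inv (Efron–Stein slack on the free family: parity-like `F` are fine,
the risk is an invariant `F` that is noise-INsensitive under planted pinning at a coupling where UP holds —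
no such example is known; at `β = 0` Hoeffding forbids it).  Size XL / open.  Leans on: S2 (`EB`,
hypothesis), FS (hypothesis), `wilsonMeasure_map_gaugeTransform_holds`, `IsGaugeInvariant`, Mathlib `condExp`,
martingale API; literature (unproved, none vendored): Chen–Eldan arXiv:2203.04163 §2.1.1 / Thm 24,
Anari–Liu–Oveis Gharan arXiv:2001.00303.  `stub_sparseLocalToGlobal_iff`: this is `∀ G, IsCompactSimpleLieGroup G →
SimplyConnectedSpace G → ∀ r β, 0 ≤ β → ElitzurBessel G r β → FiniteSusceptibility G r β → ∃ C ≥ 0,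
SparseLocalToGlobalAt G r β C`. -/
theorem stub_sparseLocalToGlobal :
    ∀ (G : Type) [Group G] [TopologicalSpace G] [IsTopologicalGroup G] [CompactSpace G]
      [MeasurableSpace G] [BorelSpace G],
      Literature.MathematicalPhysics.QuantumFieldTheory.IsCompactSimpleLieGroup G →
      SimplyConnectedSpace G →
      ∀ (r : Literature.MathematicalPhysics.QuantumFieldTheory.LatticeRep G) (β : ℝ), 0 ≤ β →
        -- EB(G,r,β): spectral independence of the unpinned measures with constant 1 (= S2)
        (∀ S : ℕ, 1 ≤ S →
          ∀ φ : Literature.MathematicalPhysics.QuantumFieldTheory.GaugeConfig 4 (2 * S + 1) G → ℝ,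
            Measurable φ → (∃ M : ℝ, ∀ U, |φ U| ≤ M) →
              ∑ ℓ : Literature.MathematicalPhysics.QuantumFieldTheory.Edge 4 (2 * S + 1),
                ProbabilityTheory.variance
                  ((Literature.MathematicalPhysics.QuantumFieldTheory.wilsonMeasure (d := 4)
                      (L := 2 * S + 1) r.ρ β)[φ |
                    MeasurableSpace.comap
                      (fun V : Literature.MathematicalPhysics.QuantumFieldTheory.GaugeConfig 4
                        (2 * S + 1) G => V ℓ) inferInstance])
                  (Literature.MathematicalPhysics.QuantumFieldTheory.wilsonMeasure (d := 4)
                    (L := 2 * S + 1) r.ρ β) ≤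
                ProbabilityTheory.variance φ
                  (Literature.MathematicalPhysics.QuantumFieldTheory.wilsonMeasure (d := 4)
                    (L := 2 * S + 1) r.ρ β)) →
        -- FS(G,r,β): finite gauge-invariant susceptibility (the crux hypothesis, verbatim)
        (∀ A B : Literature.MathematicalPhysics.QuantumFieldTheory.YMSpecies G, ∃ χ : ℝ, ∀ S : ℕ,
          ∑ x ∈ Literature.Probability.LatticeModels.box 4 S,
            |ProbabilityTheory.covariance
                (fun U => A.F (Literature.MathematicalPhysics.QuantumLattice.torusLift (2 * S + 1) U))
                (fun U => B.F (Literature.MathematicalPhysics.QuantumLattice.configShift (-x)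
                  (Literature.MathematicalPhysics.QuantumLattice.torusLift (2 * S + 1) U)))
                (Literature.MathematicalPhysics.QuantumFieldTheory.wilsonMeasure (d := 4)
                  (L := 2 * S + 1) r.ρ β)| ≤ χ) →
        ∃ C : ℝ, 0 ≤ C ∧ ∀ (S : ℕ), 1 ≤ S →
          ∀ (F : Literature.MathematicalPhysics.QuantumFieldTheory.GaugeConfig 4 (2 * S + 1) G → ℝ),
            Measurable F → (∃ M : ℝ, ∀ U, |F U| ≤ M) →
            Literature.MathematicalPhysics.QuantumFieldTheory.IsGaugeInvariant F →
              ProbabilityTheory.variance F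
                  (Literature.MathematicalPhysics.QuantumFieldTheory.wilsonMeasure (d := 4)
                    (L := 2 * S + 1) r.ρ β) ≤
                C * ((((2 * S + 1) ^ 4 : ℕ) : ℝ)⁻¹ *
                  ∑ i : Fin 4, ∑ a : Literature.MathematicalPhysics.QuantumFieldTheory.Site 4 (2 * S + 1),
                    ∫ U, (F U - ((Literature.MathematicalPhysics.QuantumFieldTheory.wilsonMeasure (d := 4)
                        (L := 2 * S + 1) r.ρ β)[F | MeasureTheory.cylinderEvents
                          (X := fun _ : Literature.MathematicalPhysics.QuantumFieldTheory.Edge 4 (2 * S + 1)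
                            => G)
                          {ℓ : Literature.MathematicalPhysics.QuantumFieldTheory.Edge 4 (2 * S + 1) |
                            ℓ.2 = i ∧ ∀ ν, Odd (ℓ.1 ν - a ν).val}ᶜ]) U) ^ 2
                      ∂(Literature.MathematicalPhysics.QuantumFieldTheory.wilsonMeasure (d := 4)
                        (L := 2 * S + 1) r.ρ β)) := by
  sorry

/-- **S5 · the centreless residual — NOT claimed by the line** (`stub_centrelessResidual`, scope sentinel).
`IsCompactSimpleLieGroup G` admits centreless compact simple groups (`SO(3)`, `PSU(N)`, …: `π₁(G) ≠ 0`), where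
the CONCLUSION `UP` of the crux is false modulo the 't Hooft twist-sector inputs
`Literature.MathematicalPhysics.QuantumFieldTheory.TwistSectorInputs` (cdisprove: negative lemma p76563,
`Theorems/SusceptibilityToPoincare/Negative/FalseOfTwistSectorInputs.lean`; Disproof.lean §2–§3) while `FS` is
expected to hold, and the line's mechanism is void.  This stub is the crux's implication `FS → UP_inv`
restricted to `¬ SimplyConnectedSpace G`, isolated so that (i) the positive stubs state only what the line
believes TRUE, (ii) `¬ S5` is literally `¬ crux` on centreless `G`, (iii) a re-scoping of the crux to
simply-connected `G` (recommended by every seat that looked) makes it vacuous with S1–S4, T0, T1 untouched.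
NO prover should staff it positively.  `stub_centrelessResidual_iff`: this is `∀ G, IsCompactSimpleLieGroup G →
¬ SimplyConnectedSpace G → ∀ r β, 0 ≤ β → FiniteSusceptibility G r β → UniformPoincareInv G r β`. -/
theorem stub_centrelessResidual :
    ∀ (G : Type) [Group G] [TopologicalSpace G] [IsTopologicalGroup G] [CompactSpace G]
      [MeasurableSpace G] [BorelSpace G],
      Literature.MathematicalPhysics.QuantumFieldTheory.IsCompactSimpleLieGroup G →
      ¬ SimplyConnectedSpace G →
      ∀ (r : Literature.MathematicalPhysics.QuantumFieldTheory.LatticeRep G) (β : ℝ), 0 ≤ β →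
        (∀ A B : Literature.MathematicalPhysics.QuantumFieldTheory.YMSpecies G, ∃ χ : ℝ, ∀ S : ℕ,
          ∑ x ∈ Literature.Probability.LatticeModels.box 4 S,
            |ProbabilityTheory.covariance
                (fun U => A.F (Literature.MathematicalPhysics.QuantumLattice.torusLift (2 * S + 1) U))
                (fun U => B.F (Literature.MathematicalPhysics.QuantumLattice.configShift (-x)
                  (Literature.MathematicalPhysics.QuantumLattice.torusLift (2 * S + 1) U)))
                (Literature.MathematicalPhysics.QuantumFieldTheory.wilsonMeasure (d := 4)
                  (L := 2 * S + 1) r.ρ β)| ≤ χ) →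
        ∃ C : ℝ, ∀ S : ℕ,
          ∀ F : Literature.MathematicalPhysics.QuantumFieldTheory.GaugeConfig 4 (2 * S + 1) G → ℝ,
            Measurable F → (∃ M : ℝ, ∀ U, |F U| ≤ M) →
            Literature.MathematicalPhysics.QuantumFieldTheory.IsGaugeInvariant F →
              ProbabilityTheory.variance F
                  (Literature.MathematicalPhysics.QuantumFieldTheory.wilsonMeasure (d := 4)
                    (L := 2 * S + 1) r.ρ β) ≤
                C * ∑ ℓ : Literature.MathematicalPhysics.QuantumFieldTheory.Edge 4 (2 * S + 1),
                  ∫ U, ∫ g, (F U - F (Function.update U ℓ g)) ^ 2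
                    ∂((Literature.MathematicalPhysics.QuantumFieldTheory.haarProbability G).tilted
                      (fun g' => -β * Literature.MathematicalPhysics.QuantumFieldTheory.wilsonAction
                        r.ρ (Function.update U ℓ g')))
                    ∂(Literature.MathematicalPhysics.QuantumFieldTheory.wilsonMeasure (d := 4)
                      (L := 2 * S + 1) r.ρ β) := by
  sorry

/-! ## `Iff.rfl` bridges: each stub is the readable statement it claims to be -/

theorem stub_orbitSlice_iff :
    type_of% stub_orbitSlice ↔
      ∀ (G : Type) [Group G] [TopologicalSpace G] [IsTopologicalGroup G] [CompactSpace G]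
        [MeasurableSpace G] [BorelSpace G], ∀ (r : LatticeRep G) (β : ℝ), 0 ≤ β →
        UniformPoincareInv G r β → UniformPoincare G r β :=
  Iff.rfl

theorem stub_elitzurBessel_iff :
    type_of% stub_elitzurBessel ↔
      ∀ (G : Type) [Group G] [TopologicalSpace G] [IsTopologicalGroup G] [CompactSpace G]
        [MeasurableSpace G] [BorelSpace G], ∀ (r : LatticeRep G) (β : ℝ), ElitzurBessel G r β := by
  constructor
  · intro h G _ _ _ _ _ _ r β S hS φ hφ hb
    exact h G r β S hS φ hφ hb
  · intro h G _ _ _ _ _ _ r β S hS φ hφ hb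
    exact h G r β S hS φ hφ hb

theorem stub_gibbsSparseEfronStein_iff :
    type_of% stub_gibbsSparseEfronStein ↔ GibbsSparseEfronStein :=
  Iff.rfl

theorem stub_sparseTerminal_iff :
    type_of% stub_sparseTerminal ↔
      ∀ (G : Type) [Group G] [TopologicalSpace G] [IsTopologicalGroup G] [CompactSpace G]
        [MeasurableSpace G] [BorelSpace G], ∀ (r : LatticeRep G) (β : ℝ),
        GibbsSparseEfronStein → ∃ C : ℝ, 0 ≤ C ∧ SparseTerminalAt G r β C :=
  Iff.rfl

theorem stub_sparseLocalToGlobal_iff :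
    type_of% stub_sparseLocalToGlobal ↔
      ∀ (G : Type) [Group G] [TopologicalSpace G] [IsTopologicalGroup G] [CompactSpace G]
        [MeasurableSpace G] [BorelSpace G], IsCompactSimpleLieGroup G → SimplyConnectedSpace G →
        ∀ (r : LatticeRep G) (β : ℝ), 0 ≤ β → ElitzurBessel G r β → FiniteSusceptibility G r β →
        ∃ C : ℝ, 0 ≤ C ∧ SparseLocalToGlobalAt G r β C :=
  Iff.rfl

theorem stub_centrelessResidual_iff :
    type_of% stub_centrelessResidual ↔
      ∀ (G : Type) [Group G] [TopologicalSpace G] [IsTopologicalGroup G] [CompactSpace G]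
        [MeasurableSpace G] [BorelSpace G], IsCompactSimpleLieGroup G → ¬ SimplyConnectedSpace G →
        ∀ (r : LatticeRep G) (β : ℝ), 0 ≤ β → FiniteSusceptibility G r β → UniformPoincareInv G r β :=
  Iff.rfl

/-! ## Composition (closed glue on the named predicates, then the crux BY NAME from the stubs) -/

section Glue

variable {G : Type} [Group G] [TopologicalSpace G] [IsTopologicalGroup G] [CompactSpace G]
  [MeasurableSpace G] [BorelSpace G]

/-- The heat-bath Dirichlet form is non-negative (integrals of squares). -/
theorem hbDirichlet_nonneg (r : LatticeRep G) (β : ℝ) (S : ℕ) (F : GaugeConfig 4 (2 * S + 1) G → ℝ) :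
    0 ≤ hbDirichlet G r β S F :=
  Summit.QuantumFields.YangMills.Theorems.SusceptibilityToPoincare.Transfer.hbForm_nonneg r β S F

/-- Middle + terminal stage (for `S ≥ 1`) and the per-volume inequality at `S = 0` give `UP_inv`. -/
theorem uniformPoincareInv_of_sparse (r : LatticeRep G) (β CM CT : ℝ) (hCM : 0 ≤ CM)
    (hM : SparseLocalToGlobalAt G r β CM) (hT : SparseTerminalAt G r β CT) :
    UniformPoincareInv G r β := by
  obtain ⟨C₀, hC₀⟩ :=
    Summit.QuantumFields.YangMills.Theorems.SusceptibilityToPoincare.perVolume_heatBathPoincare G r β 0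
  refine ⟨max (CM * CT) C₀, fun S F hF hB hI => ?_⟩
  have hnn : 0 ≤ hbDirichlet G r β S F := hbDirichlet_nonneg r β S F
  rcases Nat.eq_zero_or_pos S with hS | hS
  · subst hS
    exact (hC₀ F hF hB).trans (mul_le_mul_of_nonneg_right (le_max_right _ _) hnn)
  · calc ProbabilityTheory.variance F (wilsonMeasure (d := 4) (L := 2 * S + 1) r.ρ β)
        ≤ CM * sparseCondVar G r β S F := hM S hS F hF hB hI
      _ ≤ CM * (CT * hbDirichlet G r β S F) := mul_le_mul_of_nonneg_left (hT S F hF hB) hCM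
      _ = (CM * CT) * hbDirichlet G r β S F := by ring
      _ ≤ max (CM * CT) C₀ * hbDirichlet G r β S F :=
          mul_le_mul_of_nonneg_right (le_max_left _ _) hnn

/-- The simply-connected case of the crux from S2, T0, T1, S4 (as hypotheses) and S1. -/
theorem uniformPoincare_of_stubs (h1 : type_of% stub_orbitSlice) (h2 : type_of% stub_elitzurBessel)
    (h0 : type_of% stub_gibbsSparseEfronStein) (h3 : type_of% stub_sparseTerminal)
    (h4 : type_of% stub_sparseLocalToGlobal)
    (hG : IsCompactSimpleLieGroup G) (hsc : SimplyConnectedSpace G) (r : LatticeRep G) (β : ℝ)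
    (hβ : 0 ≤ β) (hFS : FiniteSusceptibility G r β) : UniformPoincare G r β := by
  refine h1 G r β hβ ?_
  obtain ⟨CT, -, hT⟩ := h3 G r β h0
  obtain ⟨CM, hCM, hM⟩ := h4 G hG hsc r β hβ (h2 G r β) hFS
  exact uniformPoincareInv_of_sparse r β CM CT hCM hM hT

end Glue

/-- **The line concludes the crux.** `SusceptibilityToPoincare` BY NAME from the six registered stubs:
orbit-slice transfer (S1, closed) to invariant `F`; for simply-connected `G` the sparse planted chain
`Var ≤ C_M · SCV ≤ C_M C_T · ℰ_hb` (S4 fed with S2 and FS; T1 fed with T0; `S = 0` per-volume); for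
centreless `G` the unclaimed residual S5. -/
theorem SusceptibilityToPoincare_of : SusceptibilityToPoincare := by
  intro G _ _ _ _ _ _ hG r β hβ hFS
  by_cases hsc : SimplyConnectedSpace G
  · exact uniformPoincare_of_stubs stub_orbitSlice stub_elitzurBessel stub_gibbsSparseEfronStein
      stub_sparseTerminal stub_sparseLocalToGlobal hG hsc r β hβ hFS
  · exact stub_orbitSlice G r β hβ (stub_centrelessResidual G hG hsc r β hβ hFS)

end Summit.QuantumFields.YangMills.Cruxes.SusceptibilityToPoincare.PlantedLinkPinning
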